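import Literature.MathematicalPhysics.QuantumLattice.QuantumRotorGroundState
import Literature.MathematicalPhysics.QuantumLattice.ProductOperators
import Literature.MathematicalPhysics.QuantumLattice.FinDimSpectrum
import HarnessLib

/-!
# The momentum-truncated quantum rotor as a finite spin system (Galerkin matrices)

Sibling file of `QuantumRotorGroundState.lean` (item
`provefact-Literature.MathematicalPhysics.QuantumLa-0bccfc6de5`, the named fact
`QuantumRotor.KleinPerez1992_rotorGroundStateLRO`: ground-state long-range order of the ferromagnetic
quantum rotators `H_Λ = Σ_x (h/2)(-∂²/∂φ_x²) - J Σ_{⟨xy⟩} cos(φ_x - φ_y)` on the even discrete tori,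
Klein–Perez, Commun. Math. Phys. 147 (1992), p. 243; proved in print by Wojtkiewicz–Pusz–Stachura,
Rep. Math. Phys. 77 (2016), Thm. 3.3, by reflection positivity and the Kennedy–Lieb–Shastry
`T = 0` infrared bound). No statement of that file is touched. This file sets up the
**finite-dimensional approximation** through which the tree's matrix machinery for the
Kennedy–Lieb–Shastry method (`XYOrder*.lean`: `Matrix.groundEnergy`, the tracial
`Matrix.groundStateFunctional`, `Matrix.kls_groundEnergy_reflection`,
`Matrix.groundState_infraredBound`) applies to the rotators: the Galerkin compression of `H_Λ` to
the trigonometric polynomials of degree `≤ M` in every angle.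

In the momentum basis `e_n(φ) = e^{inφ}/√(2π)`, `n ∈ {-M, …, M}` (index `a : Fin (2M+1)`,
`n = a - M`), of one rotator:

* `truncRaise M` — the compression `U` of the multiplication operator `e^{iφ}`: `U e_n = e_{n+1}`
  (`n < M`), `U e_M = 0`; a real matrix;
* `truncCos M = ½(U + Uᵀ)`, `truncSin M = (U - Uᵀ)/(2i)` — the compressions of `cos φ`, `sin φ`
  (Hermitian; `truncCos` and `i · truncSin` are real);
* `truncMomentum M = diag(n)` — the angular momentum `-i∂/∂φ` (real diagonal), and the edge
  projections `truncTop M`, `truncBot M` onto `e_M`, `e_{-M}`;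
* on a finite set of sites `Λ` (local dimension `2M+1`, the tree's `Op Λ (2M+1)`): the bond operator
  `truncBond M x y = cos_x cos_y + sin_x sin_y`, which IS the compression of `cos(φ_x - φ_y)`
  (`= ½(U_x U_yᵀ + U_xᵀ U_y)` for `x ≠ y`), and the compressed Hamiltonian
  `truncHamiltonian M nn h J = Σ_x (h/2) N_x² - (J/2) Σ_x Σ_{y ∼ x} truncBond M x y`
  (the double sum over a symmetric neighbour relation counts every bond twice, whence `J/2`, exactly
  as in `QuantumRotor.energy`).

Main algebraic facts (all proved): `Uᵀ U = 1 - P_M`, `U Uᵀ = 1 - P_{-M}`, `N U = U (N + 1)`,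
`cos² + sin² = 1 - ½(P_M + P_{-M})` (the truncation defect of the sum rule),
`[cos, sin] = (P_{-M} - P_M)/(2i)`, the Chebyshev bound `M² (P_M + P_{-M}) ≤ N²`, Hermiticity and
reality of all the pieces, Hermiticity of `truncHamiltonian`.

## References

* J. Wojtkiewicz, W. Pusz, P. Stachura, *Operator reflection positivity inequalities and their
  applications to interacting quantum rotors*, Rep. Math. Phys. 77 (2016) 183–209
  (arXiv:1507.03079), §3.1 (the model), §§3.3–3.4 (the proof of Thm. 3.3)
  [WojtkiewiczPuszStachura2016].
* T. Kennedy, E. H. Lieb, B. S. Shastry, J. Stat. Phys. 53 (1988) 1019–1030 and Phys. Rev. Lett.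
  61 (1988) 2582–2584 (the `T = 0` method) [KLS1988JSP, KLS1988PRL].
* A. Klein, J. F. Perez, Commun. Math. Phys. 147 (1992) 241–252, (2.1) [KleinPerez1992].
-/

noncomputable section

open Matrix Complex Finset
open scoped ComplexOrder

namespace Literature.MathematicalPhysics.QuantumLattice

namespace QuantumRotor

/-! ### One rotator: the truncated shift, cosine, sine, momentum -/

section Local

variable (M : ℕ)

/-- The truncated raising operator `U` on `ℂ^{2M+1}` (momenta `n = a - M`, `a : Fin (2M+1)`):
`U e_b = e_{b+1}` for `b < 2M`, `U e_{2M} = 0`; the Galerkin compression of multiplication by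
`e^{iφ}`. Entry `U a b = 1` iff `a = b + 1`. [cite: WojtkiewiczPuszStachura2016, §3.1] -/
def truncRaise : Matrix (Fin (2 * M + 1)) (Fin (2 * M + 1)) ℂ :=
  of fun a b => if a.val = b.val + 1 then 1 else 0

/-- The compression of `cos φ`: `½(U + Uᵀ)` (real symmetric). [cite: WojtkiewiczPuszStachura2016, §3.1] -/
def truncCos : Matrix (Fin (2 * M + 1)) (Fin (2 * M + 1)) ℂ :=
  (1 / 2 : ℂ) • (truncRaise M + (truncRaise M)ᵀ)

/-- The compression of `sin φ`: `(U - Uᵀ)/(2i) = (-i/2)(U - Uᵀ)` (Hermitian, purely imaginary).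
[cite: WojtkiewiczPuszStachura2016, §3.1] -/
def truncSin : Matrix (Fin (2 * M + 1)) (Fin (2 * M + 1)) ℂ :=
  (-I / 2 : ℂ) • (truncRaise M - (truncRaise M)ᵀ)

/-- The angular momentum `N = -i∂/∂φ = diag(a - M)` in the momentum basis.
[cite: WojtkiewiczPuszStachura2016, §3.1] -/
def truncMomentum : Matrix (Fin (2 * M + 1)) (Fin (2 * M + 1)) ℂ :=
  diagonal fun a => ((a.val : ℂ) - (M : ℂ))

/-- The projection `P_M` onto the top momentum state `e_M` (`a = 2M = Fin.last`). [folklore] -/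
def truncTop : Matrix (Fin (2 * M + 1)) (Fin (2 * M + 1)) ℂ :=
  diagonal fun a => if a = Fin.last (2 * M) then 1 else 0

/-- The projection `P_{-M}` onto the bottom momentum state `e_{-M}` (`a = 0`). [folklore] -/
def truncBot : Matrix (Fin (2 * M + 1)) (Fin (2 * M + 1)) ℂ :=
  diagonal fun a => if a = 0 then 1 else 0

/-! #### Entries -/

/-- Entries of `U`. [folklore] -/
theorem truncRaise_apply (a b : Fin (2 * M + 1)) :
    truncRaise M a b = if a.val = b.val + 1 then 1 else 0 := rfl

/-- Entries of `Uᵀ`. [folklore] -/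
theorem truncRaise_transpose_apply (a b : Fin (2 * M + 1)) :
    (truncRaise M)ᵀ a b = if b.val = a.val + 1 then 1 else 0 := rfl

/-- Entries of `N`. [folklore] -/
theorem truncMomentum_apply (a b : Fin (2 * M + 1)) :
    truncMomentum M a b = if a = b then ((a.val : ℂ) - (M : ℂ)) else 0 := by
  simp [truncMomentum, diagonal_apply]

/-- Entries of `P_M`. [folklore] -/
theorem truncTop_apply (a b : Fin (2 * M + 1)) :
    truncTop M a b = if a = b ∧ a = Fin.last (2 * M) then 1 else 0 := by
  by_cases hab : a = b
  · subst hab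
    simp [truncTop]
  · simp [truncTop, hab]

/-- Entries of `P_{-M}`. [folklore] -/
theorem truncBot_apply (a b : Fin (2 * M + 1)) :
    truncBot M a b = if a = b ∧ a = 0 then 1 else 0 := by
  by_cases hab : a = b
  · subst hab
    simp [truncBot]
  · simp [truncBot, hab]

/-! #### Reality: all entries are fixed by complex conjugation (except `truncSin`, which is
purely imaginary) -/

/-- The entries of `U` are real. [folklore] -/
theorem star_truncRaise_apply (a b : Fin (2 * M + 1)) :
    star (truncRaise M a b) = truncRaise M a b := by
  rw [truncRaise_apply]
  split_ifs <;> simp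

/-- `Uᴴ = Uᵀ` (`U` is real). [folklore] -/
theorem truncRaise_conjTranspose : (truncRaise M)ᴴ = (truncRaise M)ᵀ := by
  ext a b
  rw [conjTranspose_apply, transpose_apply, star_truncRaise_apply]

/-- `(Uᵀ)ᴴ = U`. [folklore] -/
theorem truncRaise_transpose_conjTranspose : ((truncRaise M)ᵀ)ᴴ = truncRaise M := by
  rw [← truncRaise_conjTranspose, conjTranspose_conjTranspose]

/-- `cos` is real symmetric: `cosᵀ = cos`. [folklore] -/
theorem truncCos_transpose : (truncCos M)ᵀ = truncCos M := by
  rw [truncCos, transpose_smul, transpose_add, transpose_transpose, add_comm (truncRaise M)ᵀ]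

/-- `cos` is Hermitian. [folklore] -/
theorem truncCos_isHermitian : (truncCos M).IsHermitian := by
  rw [IsHermitian, truncCos, conjTranspose_smul, conjTranspose_add, truncRaise_conjTranspose,
    truncRaise_transpose_conjTranspose, add_comm (truncRaise M)ᵀ]
  congr 1
  simp

/-- `cosᴴ = cosᵀ` (reality, in the form used by `Matrix.kls_groundEnergy_reflection`). [folklore] -/
theorem truncCos_transpose_eq_conjTranspose : (truncCos M)ᵀ = (truncCos M)ᴴ := by
  rw [truncCos_transpose, (truncCos_isHermitian M).eq]

/-- `sin` is Hermitian. [folklore] -/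
theorem truncSin_isHermitian : (truncSin M).IsHermitian := by
  rw [IsHermitian, truncSin, conjTranspose_smul, conjTranspose_sub, truncRaise_conjTranspose,
    truncRaise_transpose_conjTranspose]
  rw [show star (-I / 2 : ℂ) = I / 2 by simp [Complex.conj_I, neg_div]]
  rw [← neg_sub (truncRaise M), smul_neg, ← neg_smul, neg_div]

/-- `sinᵀ = -sin` (antisymmetric). [folklore] -/
theorem truncSin_transpose : (truncSin M)ᵀ = -truncSin M := by
  rw [truncSin, transpose_smul, transpose_sub, transpose_transpose, ← neg_sub (truncRaise M),
    smul_neg]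

/-- `i · sin = ½(U - Uᵀ)` is a real matrix: `(i sin)ᵀ = (i sin)ᴴ`. [folklore] -/
theorem I_smul_truncSin : I • truncSin M = (1 / 2 : ℂ) • (truncRaise M - (truncRaise M)ᵀ) := by
  rw [truncSin, smul_smul]
  congr 1
  rw [mul_div_assoc', mul_neg, Complex.I_mul_I, neg_neg]

/-- `i · sin` is a real matrix: its transpose is its conjugate transpose. [folklore] -/
theorem I_smul_truncSin_transpose_eq_conjTranspose : (I • truncSin M)ᵀ = (I • truncSin M)ᴴ := by
  rw [I_smul_truncSin, transpose_smul, conjTranspose_smul, transpose_sub, conjTranspose_sub,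
    transpose_transpose, truncRaise_conjTranspose, truncRaise_transpose_conjTranspose]
  congr 1
  simp

/-- `N` is Hermitian (real diagonal). [folklore] -/
theorem truncMomentum_isHermitian : (truncMomentum M).IsHermitian := by
  rw [IsHermitian, truncMomentum, diagonal_conjTranspose]
  congr 1
  funext a
  simp

/-- `N` is symmetric (diagonal). [folklore] -/
theorem truncMomentum_transpose : (truncMomentum M)ᵀ = truncMomentum M :=
  diagonal_transpose _

/-- `P_M` is Hermitian. [folklore] -/
theorem truncTop_isHermitian : (truncTop M).IsHermitian := by
  rw [IsHermitian, truncTop, diagonal_conjTranspose]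
  congr 1
  funext a
  by_cases h : a = Fin.last (2 * M) <;> simp [h]

/-- `P_{-M}` is Hermitian. [folklore] -/
theorem truncBot_isHermitian : (truncBot M).IsHermitian := by
  rw [IsHermitian, truncBot, diagonal_conjTranspose]
  congr 1
  funext a
  by_cases h : a = 0 <;> simp [h]

/-- `P_M` is symmetric. [folklore] -/
theorem truncTop_transpose : (truncTop M)ᵀ = truncTop M := diagonal_transpose _

/-- `P_{-M}` is symmetric. [folklore] -/
theorem truncBot_transpose : (truncBot M)ᵀ = truncBot M := diagonal_transpose _

/-! #### Products: `Uᵀ U = 1 - P_M`, `U Uᵀ = 1 - P_{-M}`, `[N, U] = U` -/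

/-- A sum over `Fin n` against the indicator of `c.val = k` picks out at most one term. [folklore] -/
theorem sum_ite_val_eq {n : ℕ} (k : ℕ) (f : Fin n → ℂ) :
    ∑ c : Fin n, (if c.val = k then f c else 0) = if h : k < n then f ⟨k, h⟩ else 0 := by
  split_ifs with h
  · rw [Finset.sum_eq_single ⟨k, h⟩]
    · simp
    · intro c _ hc
      rw [if_neg]
      intro hck
      exact hc (Fin.ext hck)
    · simp
  · refine Finset.sum_eq_zero fun c _ => ?_
    rw [if_neg]
    intro hck
    exact h (hck ▸ c.isLt)

/-- `Uᵀ U = 1 - P_M`: `U` is an isometry on `e_{-M}, …, e_{M-1}` and kills `e_M`. [folklore] -/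
theorem truncRaise_transpose_mul_self :
    (truncRaise M)ᵀ * truncRaise M = 1 - truncTop M := by
  ext a b
  simp only [Matrix.mul_apply, truncRaise_transpose_apply, truncRaise_apply, Matrix.sub_apply,
    Matrix.one_apply, truncTop_apply]
  have hsum : ∑ c : Fin (2 * M + 1), ((if c.val = a.val + 1 then (1 : ℂ) else 0) *
      if c.val = b.val + 1 then 1 else 0) =
      ∑ c : Fin (2 * M + 1), (if c.val = a.val + 1 then
        (if a.val = b.val then (1 : ℂ) else 0) else 0) := by
    refine sum_congr rfl fun c _ => ?_
    by_cases hc : c.val = a.val + 1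
    · simp only [hc, if_true, one_mul, add_left_inj]
    · simp only [hc, if_false, zero_mul]
  rw [hsum, sum_ite_val_eq]
  by_cases hab : a = b
  · subst hab
    by_cases hlast : a = Fin.last (2 * M)
    · have ha : ¬ a.val + 1 < 2 * M + 1 := by rw [hlast, Fin.val_last]; omega
      rw [dif_neg ha]
      simp [hlast]
    · have ha : a.val + 1 < 2 * M + 1 := by
        have h1 : a.val < 2 * M + 1 := a.isLt
        have h2 : a.val ≠ 2 * M := fun h => hlast (Fin.ext (by rw [h, Fin.val_last]))
        omega
      rw [dif_pos ha]
      simp [hlast]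
  · have hab' : a.val ≠ b.val := fun h => hab (Fin.ext h)
    simp [hab, hab']

/-- `U Uᵀ = 1 - P_{-M}`. [folklore] -/
theorem truncRaise_mul_transpose :
    truncRaise M * (truncRaise M)ᵀ = 1 - truncBot M := by
  ext a b
  simp only [Matrix.mul_apply, truncRaise_transpose_apply, truncRaise_apply, Matrix.sub_apply,
    Matrix.one_apply, truncBot_apply]
  by_cases ha0 : a = 0
  · -- row `a = 0` of `U` vanishes
    have hz : ∀ c : Fin (2 * M + 1), ¬ (a.val = c.val + 1) := by
      intro c h
      rw [ha0, Fin.val_zero] at h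
      omega
    rw [Finset.sum_eq_zero fun c _ => by rw [if_neg (hz c), zero_mul]]
    by_cases hab : a = b
    · subst hab
      simp [ha0]
    · simp [hab]
  · have ha1 : 1 ≤ a.val :=
      Nat.one_le_iff_ne_zero.2 fun h => ha0 (Fin.ext (by rw [h, Fin.val_zero]))
    have hlt : a.val - 1 < 2 * M + 1 := by have := a.isLt; omega
    have hsum : ∑ c : Fin (2 * M + 1), ((if a.val = c.val + 1 then (1 : ℂ) else 0) *
        if b.val = c.val + 1 then 1 else 0) =
        ∑ c : Fin (2 * M + 1), (if c.val = a.val - 1 then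
          (if a = b then (1 : ℂ) else 0) else 0) := by
      refine sum_congr rfl fun c _ => ?_
      by_cases hc : c.val = a.val - 1
      · have hac : a.val = c.val + 1 := by omega
        rw [if_pos hac, one_mul, if_pos hc]
        by_cases hab : a = b
        · rw [if_pos hab, if_pos (by rw [← hab]; exact hac)]
        · have : b.val ≠ c.val + 1 := fun h => hab (Fin.ext (by omega))
          rw [if_neg hab, if_neg this]
      · have hac : ¬ a.val = c.val + 1 := by omega
        simp only [hac, if_false, zero_mul, hc]
    rw [hsum, sum_ite_val_eq, dif_pos hlt]
    by_cases hab : a = b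
    · subst hab
      simp [ha0]
    · simp [hab]

/-- `U` kills the top state: `U P_M = 0`. [folklore] -/
theorem truncRaise_mul_truncTop : truncRaise M * truncTop M = 0 := by
  ext a b
  rw [truncTop, mul_diagonal, truncRaise_apply, Matrix.zero_apply]
  by_cases hb : b = Fin.last (2 * M)
  · have : ¬ a.val = b.val + 1 := by rw [hb, Fin.val_last]; have := a.isLt; omega
    simp [this]
  · simp [hb]

/-- `P_{-M} U = 0`. [folklore] -/
theorem truncBot_mul_truncRaise : truncBot M * truncRaise M = 0 := by
  ext a b
  rw [truncBot, diagonal_mul, truncRaise_apply, Matrix.zero_apply]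
  by_cases ha : a = 0
  · have : ¬ a.val = b.val + 1 := by rw [ha, Fin.val_zero]; omega
    simp [this]
  · simp [ha]

/-- `[N, U] = U`: raising the momentum by one, `N U = U N + U`. [folklore] -/
theorem truncMomentum_mul_truncRaise :
    truncMomentum M * truncRaise M = truncRaise M * truncMomentum M + truncRaise M := by
  ext a b
  rw [truncMomentum, diagonal_mul, Matrix.add_apply, mul_diagonal, truncRaise_apply]
  by_cases hab : a.val = b.val + 1
  · simp only [hab, if_true, mul_one, one_mul]
    push_cast
    ring
  · simp [hab]

/-- `[N, Uᵀ] = -Uᵀ`: `Uᵀ N = N Uᵀ + Uᵀ`. [folklore] -/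
theorem truncRaise_transpose_mul_truncMomentum :
    (truncRaise M)ᵀ * truncMomentum M = truncMomentum M * (truncRaise M)ᵀ + (truncRaise M)ᵀ := by
  have h := congrArg transpose (truncMomentum_mul_truncRaise M)
  rw [transpose_mul, transpose_add, transpose_mul, truncMomentum_transpose] at h
  exact h

/-! #### `cos² + sin²`, `[cos, sin]`, and the Chebyshev bound on the edge projections -/

/-- `cos² + sin² = 1 - ½(P_M + P_{-M})`: the truncation defect of the identity `cos² + sin² = 1`
lives on the two extreme momentum states. [folklore] -/
theorem truncCos_sq_add_truncSin_sq :
    truncCos M * truncCos M + truncSin M * truncSin M =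
      1 - (1 / 2 : ℂ) • (truncTop M + truncBot M) := by
  have h1 := truncRaise_transpose_mul_self M
  have h2 := truncRaise_mul_transpose M
  set U := truncRaise M
  have hc : truncCos M * truncCos M =
      (1 / 4 : ℂ) • (U * U + Uᵀ * Uᵀ + U * Uᵀ + Uᵀ * U) := by
    rw [truncCos, smul_mul_smul, add_mul, mul_add, mul_add]
    rw [show (1 / 2 : ℂ) * (1 / 2) = 1 / 4 by norm_num]
    congr 1
    abel
  have hs : truncSin M * truncSin M =
      (-1 / 4 : ℂ) • (U * U + Uᵀ * Uᵀ - U * Uᵀ - Uᵀ * U) := by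
    rw [truncSin, smul_mul_smul, sub_mul, mul_sub, mul_sub]
    rw [show (-I / 2 : ℂ) * (-I / 2) = -1 / 4 by
      rw [div_mul_div_comm, neg_mul_neg, Complex.I_mul_I]; norm_num]
    congr 1
    abel
  rw [hc, hs, h1, h2]
  module

/-- `[cos, sin] = (i/2)(P_M - P_{-M})`: `cos` and `sin` commute up to the truncation edge.
[folklore] -/
theorem truncCos_mul_truncSin_sub :
    truncCos M * truncSin M - truncSin M * truncCos M =
      (I / 2 : ℂ) • (truncTop M - truncBot M) := by
  have h1 := truncRaise_transpose_mul_self M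
  have h2 := truncRaise_mul_transpose M
  set U := truncRaise M
  have hcs : truncCos M * truncSin M =
      ((1 / 2 : ℂ) * (-I / 2)) • (U * U - Uᵀ * Uᵀ - U * Uᵀ + Uᵀ * U) := by
    rw [truncCos, truncSin, smul_mul_smul, add_mul, mul_sub, mul_sub]
    congr 1
    abel
  have hsc : truncSin M * truncCos M =
      ((1 / 2 : ℂ) * (-I / 2)) • (U * U - Uᵀ * Uᵀ + U * Uᵀ - Uᵀ * U) := by
    rw [truncCos, truncSin, smul_mul_smul, sub_mul, mul_add, mul_add, mul_comm (-I / 2 : ℂ)]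
    congr 1
    abel
  rw [hcs, hsc, h1, h2]
  module

/-- `N² = diag((a - M)²)`. [folklore] -/
theorem truncMomentum_mul_self :
    truncMomentum M * truncMomentum M = diagonal fun a : Fin (2 * M + 1) => ((a.val : ℂ) - M) ^ 2 := by
  rw [truncMomentum, diagonal_mul_diagonal]
  congr 1
  funext a
  ring

/-- **Chebyshev bound on the truncation edge**: `M² (P_M + P_{-M}) ≤ N²` (both states have
`|n| = M`). [folklore] -/
theorem posSemidef_truncMomentum_sq_sub :
    (truncMomentum M * truncMomentum M -
      ((M : ℂ) ^ 2) • (truncTop M + truncBot M)).PosSemidef := by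
  have hdiag : truncMomentum M * truncMomentum M - ((M : ℂ) ^ 2) • (truncTop M + truncBot M) =
      diagonal (fun a : Fin (2 * M + 1) => ((a.val : ℂ) - M) ^ 2 -
        (M : ℂ) ^ 2 * ((if a = Fin.last (2 * M) then 1 else 0) + (if a = 0 then 1 else 0))) := by
    rw [truncMomentum_mul_self, truncTop, truncBot, diagonal_add, ← diagonal_smul, diagonal_sub]
    rfl
  rw [hdiag, posSemidef_diagonal_iff]
  intro a
  by_cases h0 : a = 0
  · subst h0
    have hl : (0 : Fin (2 * M + 1)) ≠ Fin.last (2 * M) ∨ M = 0 := by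
      rcases Nat.eq_zero_or_pos M with hM | hM
      · exact Or.inr hM
      · left
        intro h
        have := congrArg Fin.val h
        rw [Fin.val_zero, Fin.val_last] at this
        omega
    rcases hl with hl | hM
    · simp [hl]
    · subst hM
      simp
  · by_cases hl : a = Fin.last (2 * M)
    · subst hl
      simp [h0]
      ring_nf
      exact le_rfl
    · rw [if_neg h0, if_neg hl, add_zero, mul_zero, sub_zero,
        show ((a.val : ℂ) - M) ^ 2 = (((a.val : ℝ) - M) ^ 2 : ℝ) by push_cast; ring]
      exact Complex.zero_le_real.2 (sq_nonneg _)

/-- The edge projections are positive semidefinite. [folklore] -/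
theorem posSemidef_truncTop : (truncTop M).PosSemidef := by
  rw [truncTop, posSemidef_diagonal_iff]
  intro a
  split_ifs <;> simp

/-- `P_{-M} ≥ 0`. [folklore] -/
theorem posSemidef_truncBot : (truncBot M).PosSemidef := by
  rw [truncBot, posSemidef_diagonal_iff]
  intro a
  split_ifs <;> simp

/-! #### The momentum flip `φ ↦ -φ` and the quarter turn `φ ↦ φ + π/2` -/

/-- The momentum flip `F e_n = e_{-n}` (`a ↦ 2M - a`), implementing `φ ↦ -φ`: a real symmetric
involution with `F U F = Uᵀ`. (The sublattice map of the reflection-positivity argument.)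
[folklore] -/
def truncFlip : Matrix (Fin (2 * M + 1)) (Fin (2 * M + 1)) ℂ :=
  of fun a b => if a.val + b.val = 2 * M then 1 else 0

/-- Entries of the momentum flip `F`. [folklore] -/
theorem truncFlip_apply (a b : Fin (2 * M + 1)) :
    truncFlip M a b = if a.val + b.val = 2 * M then 1 else 0 := rfl

/-- `F` is symmetric. [folklore] -/
theorem truncFlip_transpose : (truncFlip M)ᵀ = truncFlip M := by
  ext a b
  rw [transpose_apply, truncFlip_apply, truncFlip_apply, add_comm]

/-- `F` is real symmetric, hence Hermitian. [folklore] -/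
theorem truncFlip_conjTranspose : (truncFlip M)ᴴ = truncFlip M := by
  ext a b
  rw [conjTranspose_apply, truncFlip_apply, truncFlip_apply, add_comm]
  split_ifs <;> simp

/-- `Σ_c F a c · f c = f (2M - a)`. [folklore] -/
theorem sum_truncFlip_mul (a : Fin (2 * M + 1)) (f : Fin (2 * M + 1) → ℂ) :
    ∑ c, truncFlip M a c * f c = f ⟨2 * M - a.val, by omega⟩ := by
  have ha := a.isLt
  simp only [truncFlip_apply, ite_mul, one_mul, zero_mul]
  have : ∀ c : Fin (2 * M + 1), (a.val + c.val = 2 * M) ↔ (c.val = 2 * M - a.val) := fun c => by omega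
  simp_rw [this]
  rw [sum_ite_val_eq, dif_pos (by omega)]

/-- `F² = 1`. [folklore] -/
theorem truncFlip_mul_self : truncFlip M * truncFlip M = 1 := by
  ext a b
  rw [Matrix.mul_apply, sum_truncFlip_mul, truncFlip_apply, Matrix.one_apply]
  have ha := a.isLt
  by_cases hab : a = b
  · subst hab
    rw [if_pos rfl, if_pos (Nat.sub_add_cancel (by omega))]
  · have : a.val ≠ b.val := fun h => hab (Fin.ext h)
    have h2 : ¬ ((2 * M - a.val) + b.val = 2 * M) := by omega
    rw [if_neg hab, if_neg h2]

/-- `F U F = Uᵀ`: flipping the momenta turns raising into lowering. [folklore] -/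
theorem truncFlip_mul_truncRaise_mul_truncFlip :
    truncFlip M * truncRaise M * truncFlip M = (truncRaise M)ᵀ := by
  ext a b
  rw [Matrix.mul_apply, truncRaise_transpose_apply]
  have hrow : ∀ c, (truncFlip M * truncRaise M) a c = truncRaise M ⟨2 * M - a.val, by omega⟩ c :=
    fun c => by rw [Matrix.mul_apply, sum_truncFlip_mul]
  simp_rw [hrow, truncRaise_apply, truncFlip_apply, ite_mul, one_mul, zero_mul]
  have ha := a.isLt
  have hb := b.isLt
  have : ∀ c : Fin (2 * M + 1), ((2 * M - a.val : ℕ) = c.val + 1) ↔ (c.val = 2 * M - a.val - 1 ∧ a.val < 2 * M) :=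
    fun c => by constructor <;> intro h <;> omega
  simp_rw [this]
  by_cases hlt : a.val < 2 * M
  · simp only [hlt, and_true]
    rw [sum_ite_val_eq, dif_pos (by omega)]
    by_cases h : b.val = a.val + 1
    · rw [if_pos h, if_pos (by simp only; omega)]
    · rw [if_neg h, if_neg (by simp only; omega)]
  · simp only [hlt, and_false, if_false, sum_const_zero]
    rw [if_neg (by omega)]

/-- `F Uᵀ F = U`. [folklore] -/
theorem truncFlip_mul_truncRaise_transpose_mul_truncFlip :
    truncFlip M * (truncRaise M)ᵀ * truncFlip M = truncRaise M := by
  have h := congrArg transpose (truncFlip_mul_truncRaise_mul_truncFlip M)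
  rwa [transpose_mul, transpose_mul, truncFlip_transpose, transpose_transpose, ← Matrix.mul_assoc] at h

/-- `F cos F = cos`. [folklore] -/
theorem truncFlip_mul_truncCos_mul_truncFlip :
    truncFlip M * truncCos M * truncFlip M = truncCos M := by
  rw [truncCos, Matrix.mul_smul, Matrix.smul_mul, Matrix.mul_add, Matrix.add_mul,
    truncFlip_mul_truncRaise_mul_truncFlip, truncFlip_mul_truncRaise_transpose_mul_truncFlip,
    add_comm (truncRaise M)ᵀ]

/-- `F sin F = -sin`. [folklore] -/
theorem truncFlip_mul_truncSin_mul_truncFlip :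
    truncFlip M * truncSin M * truncFlip M = -truncSin M := by
  rw [truncSin, Matrix.mul_smul, Matrix.smul_mul, Matrix.mul_sub, Matrix.sub_mul,
    truncFlip_mul_truncRaise_mul_truncFlip, truncFlip_mul_truncRaise_transpose_mul_truncFlip,
    ← smul_neg, neg_sub]

/-- `F N F = -N`. [folklore] -/
theorem truncFlip_mul_truncMomentum_mul_truncFlip :
    truncFlip M * truncMomentum M * truncFlip M = -truncMomentum M := by
  ext a b
  rw [Matrix.mul_apply, Matrix.neg_apply, truncMomentum_apply]
  have hrow : ∀ c, (truncFlip M * truncMomentum M) a c =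
      truncMomentum M ⟨2 * M - a.val, by omega⟩ c :=
    fun c => by rw [Matrix.mul_apply, sum_truncFlip_mul]
  simp_rw [hrow, truncMomentum, diagonal_apply, truncFlip_apply, ite_mul, zero_mul]
  have ha := a.isLt
  rw [Finset.sum_eq_single ⟨2 * M - a.val, by omega⟩ (fun c _ hc => if_neg (fun h => hc h.symm))
    (fun h => absurd (mem_univ _) h), if_pos rfl]
  by_cases hab : a = b
  · subst hab
    rw [if_pos (Nat.sub_add_cancel (by omega)), if_pos rfl, mul_one]
    have : ((2 * M - a.val : ℕ) : ℂ) = 2 * (M : ℂ) - (a.val : ℂ) := by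
      rw [Nat.cast_sub (by omega)]; push_cast; ring
    simp only [this]
    ring
  · have : a.val ≠ b.val := fun h => hab (Fin.ext h)
    have h2 : ¬ ((2 * M - a.val) + b.val = 2 * M) := by omega
    rw [if_neg h2, mul_zero, if_neg hab, neg_zero]

/-- `F N² F = N²`. [folklore] -/
theorem truncFlip_mul_truncMomentum_sq_mul_truncFlip :
    truncFlip M * (truncMomentum M * truncMomentum M) * truncFlip M =
      truncMomentum M * truncMomentum M := by
  have h := truncFlip_mul_truncMomentum_mul_truncFlip M
  have h1 := truncFlip_mul_self M
  calc truncFlip M * (truncMomentum M * truncMomentum M) * truncFlip M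
      = (truncFlip M * truncMomentum M * truncFlip M) * (truncFlip M * truncMomentum M * truncFlip M) := by
        simp only [Matrix.mul_assoc]
        rw [← Matrix.mul_assoc (truncFlip M) (truncFlip M), h1, Matrix.one_mul]
    _ = truncMomentum M * truncMomentum M := by rw [h, neg_mul_neg]

/-- The quarter turn `R = diag(i^a)`, implementing `φ ↦ φ + π/2` (up to a phase): a diagonal
unitary with `R U Rᴴ = i U`. [folklore] -/
def truncQuarterTurn : Matrix (Fin (2 * M + 1)) (Fin (2 * M + 1)) ℂ :=
  diagonal fun a => I ^ a.val

/-- `R Rᴴ = 1`: the quarter turn is unitary. [folklore] -/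
theorem truncQuarterTurn_mul_conjTranspose :
    truncQuarterTurn M * (truncQuarterTurn M)ᴴ = 1 := by
  rw [truncQuarterTurn, diagonal_conjTranspose, diagonal_mul_diagonal, ← diagonal_one]
  congr 1
  funext a
  rw [Pi.star_apply, Complex.star_def, map_pow, Complex.conj_I, ← mul_pow, mul_neg, Complex.I_mul_I,
    neg_neg, one_pow]

/-- `Rᴴ R = 1`. [folklore] -/
theorem truncQuarterTurn_conjTranspose_mul :
    (truncQuarterTurn M)ᴴ * truncQuarterTurn M = 1 := by
  rw [truncQuarterTurn, diagonal_conjTranspose, diagonal_mul_diagonal, ← diagonal_one]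
  congr 1
  funext a
  rw [Pi.star_apply, Complex.star_def, map_pow, Complex.conj_I, ← mul_pow, neg_mul, Complex.I_mul_I,
    neg_neg, one_pow]

/-- `R U Rᴴ = i U`. [folklore] -/
theorem truncQuarterTurn_conj_truncRaise :
    truncQuarterTurn M * truncRaise M * (truncQuarterTurn M)ᴴ = I • truncRaise M := by
  ext a b
  rw [truncQuarterTurn, diagonal_conjTranspose, mul_diagonal, diagonal_mul, Matrix.smul_apply,
    truncRaise_apply, Pi.star_apply, Complex.star_def, map_pow, Complex.conj_I, smul_eq_mul]
  by_cases h : a.val = b.val + 1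
  · rw [if_pos h, h, pow_succ, mul_one, mul_one, mul_comm, ← mul_assoc, ← mul_pow, neg_mul,
      Complex.I_mul_I, neg_neg, one_pow, one_mul]
  · rw [if_neg h, mul_zero, zero_mul, mul_zero]

/-- `R Uᵀ Rᴴ = -i Uᵀ`. [folklore] -/
theorem truncQuarterTurn_conj_truncRaise_transpose :
    truncQuarterTurn M * (truncRaise M)ᵀ * (truncQuarterTurn M)ᴴ = (-I) • (truncRaise M)ᵀ := by
  ext a b
  rw [truncQuarterTurn, diagonal_conjTranspose, mul_diagonal, diagonal_mul, Matrix.smul_apply,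
    truncRaise_transpose_apply, Pi.star_apply, Complex.star_def, map_pow, Complex.conj_I, smul_eq_mul]
  by_cases h : b.val = a.val + 1
  · rw [if_pos h, h, pow_succ, mul_one, mul_one, ← mul_assoc, ← mul_pow,
      show (I : ℂ) * -I = 1 by rw [mul_neg, Complex.I_mul_I, neg_neg], one_pow, one_mul]
  · rw [if_neg h, mul_zero, zero_mul, mul_zero]

/-- `R cos Rᴴ = -sin`. [folklore] -/
theorem truncQuarterTurn_conj_truncCos :
    truncQuarterTurn M * truncCos M * (truncQuarterTurn M)ᴴ = -truncSin M := by
  rw [truncCos, Matrix.mul_smul, Matrix.smul_mul, Matrix.mul_add, Matrix.add_mul,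
    truncQuarterTurn_conj_truncRaise, truncQuarterTurn_conj_truncRaise_transpose, truncSin,
    ← neg_smul, neg_div, neg_neg, neg_smul, ← sub_eq_add_neg, ← smul_sub, smul_smul]
  congr 1
  ring

/-- `R sin Rᴴ = cos`. [folklore] -/
theorem truncQuarterTurn_conj_truncSin :
    truncQuarterTurn M * truncSin M * (truncQuarterTurn M)ᴴ = truncCos M := by
  rw [truncSin, Matrix.mul_smul, Matrix.smul_mul, Matrix.mul_sub, Matrix.sub_mul,
    truncQuarterTurn_conj_truncRaise, truncQuarterTurn_conj_truncRaise_transpose, truncCos,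
    neg_smul, sub_neg_eq_add, ← smul_add, smul_smul]
  congr 1
  rw [mul_comm, mul_div_assoc', mul_neg, Complex.I_mul_I, neg_neg]

/-- `R N Rᴴ = N` (both diagonal). [folklore] -/
theorem truncQuarterTurn_conj_truncMomentum :
    truncQuarterTurn M * truncMomentum M * (truncQuarterTurn M)ᴴ = truncMomentum M := by
  have hc : truncQuarterTurn M * truncMomentum M = truncMomentum M * truncQuarterTurn M := by
    rw [truncQuarterTurn, truncMomentum, diagonal_mul_diagonal, diagonal_mul_diagonal]
    congr 1
    funext a
    ring
  rw [hc, Matrix.mul_assoc, truncQuarterTurn_mul_conjTranspose, Matrix.mul_one]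

end Local

/-! ### Many rotators: site operators, the bond `cos(φ_x - φ_y)`, the compressed Hamiltonian -/

section Lattice

variable (M : ℕ) {Λ : Type*} [Fintype Λ] [DecidableEq Λ]

/-- `cos φ_x` (compressed), acting at site `x`. [cite: WojtkiewiczPuszStachura2016, §3.1] -/
def siteCos (x : Λ) : Op Λ (2 * M + 1) := onSite x (truncCos M)

/-- `sin φ_x` (compressed), acting at site `x`. [cite: WojtkiewiczPuszStachura2016, §3.1] -/
def siteSin (x : Λ) : Op Λ (2 * M + 1) := onSite x (truncSin M)

/-- `e^{iφ_x}` (compressed): the raising operator at site `x`. [folklore] -/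
def siteRaise (x : Λ) : Op Λ (2 * M + 1) := onSite x (truncRaise M)

/-- `e^{-iφ_x}` (compressed): the lowering operator `Uᵀ` at site `x`. [folklore] -/
def siteLower (x : Λ) : Op Λ (2 * M + 1) := onSite x (truncRaise M)ᵀ

/-- The kinetic energy `N_x² = -∂²/∂φ_x²` at site `x`. [cite: WojtkiewiczPuszStachura2016, §3.1] -/
def siteMomentumSq (x : Λ) : Op Λ (2 * M + 1) := onSite x (truncMomentum M * truncMomentum M)

/-- The bond operator `cos φ_x cos φ_y + sin φ_x sin φ_y`, the Galerkin compression of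
`cos(φ_x - φ_y)` (for `x ≠ y` it equals `½(U_x U_yᵀ + U_xᵀ U_y)`, `truncBond_eq_half`).
[cite: WojtkiewiczPuszStachura2016, §3.1 (HamRot)] -/
def truncBond (x y : Λ) : Op Λ (2 * M + 1) :=
  siteCos M x * siteCos M y + siteSin M x * siteSin M y

/-- The **compressed rotator Hamiltonian**
`H_M = Σ_x (h/2) N_x² - (J/2) Σ_x Σ_{y ∼ x} (cos φ_x cos φ_y + sin φ_x sin φ_y)`: the Galerkin
matrix of `H_Λ = Σ_x (h/2)(-∂²_{φ_x}) - J Σ_{⟨xy⟩} cos(φ_x - φ_y)` (Klein–Perez (2.1);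
[WojtkiewiczPuszStachura2016, §3.1] with `I = 1/h`) in the trigonometric polynomials of degree
`≤ M` in each angle; the double sum over the symmetric neighbour relation `nn` counts each bond
twice, as in `QuantumRotor.energy`. [cite: KleinPerez1992, §2 (2.1)]
[cite: WojtkiewiczPuszStachura2016, §3.1 (HamRot)] -/
def truncHamiltonian (nn : Λ → Λ → Prop) [DecidableRel nn] (h J : ℝ) : Op Λ (2 * M + 1) :=
  ∑ x : Λ, ((h / 2 : ℝ) : ℂ) • siteMomentumSq M x -
    ∑ x : Λ, ∑ y ∈ univ.filter (nn x), ((J / 2 : ℝ) : ℂ) • truncBond M x y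

/-! #### Hermiticity, symmetry -/

/-- `cos φ_x` is Hermitian. [folklore] -/
theorem siteCos_isHermitian (x : Λ) : (siteCos M x).IsHermitian :=
  onSite_isHermitian x (truncCos_isHermitian M)

/-- `sin φ_x` is Hermitian. [folklore] -/
theorem siteSin_isHermitian (x : Λ) : (siteSin M x).IsHermitian :=
  onSite_isHermitian x (truncSin_isHermitian M)

/-- `N_x²` is Hermitian. [folklore] -/
theorem siteMomentumSq_isHermitian (x : Λ) : (siteMomentumSq M x).IsHermitian := by
  refine onSite_isHermitian x ?_
  have h := truncMomentum_isHermitian M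
  nth_rewrite 1 [← h.eq]
  exact isHermitian_conjTranspose_mul_self _

/-- `siteLower = siteRaiseᴴ`. [folklore] -/
theorem siteRaise_conjTranspose (x : Λ) : (siteRaise M x)ᴴ = siteLower M x := by
  rw [siteRaise, siteLower, ← onSite_conjTranspose, truncRaise_conjTranspose]

/-- `siteRaise = siteLowerᴴ`. [folklore] -/
theorem siteLower_conjTranspose (x : Λ) : (siteLower M x)ᴴ = siteRaise M x := by
  rw [← siteRaise_conjTranspose, conjTranspose_conjTranspose]

/-- `cos_x = ½(U_x + U_xᵀ)`. [folklore] -/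
theorem siteCos_eq (x : Λ) :
    siteCos M x = (1 / 2 : ℂ) • (siteRaise M x + siteLower M x) := by
  rw [siteCos, truncCos, onSite_smul', onSite_add']
  rfl

/-- `sin_x = (-i/2)(U_x - U_xᵀ)`. [folklore] -/
theorem siteSin_eq (x : Λ) :
    siteSin M x = (-I / 2 : ℂ) • (siteRaise M x - siteLower M x) := by
  rw [siteSin, truncSin, onSite_smul', onSite_sub']
  rfl

/-- **The bond is the compression of `cos(φ_x - φ_y) = Re e^{i(φ_x - φ_y)}`**:
`cos_x cos_y + sin_x sin_y = ½(U_x U_yᵀ + U_xᵀ U_y)` (an identity of non-commutative algebra,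
valid also for `x = y`). [cite: WojtkiewiczPuszStachura2016, §3.1] -/
theorem truncBond_eq_half (x y : Λ) :
    truncBond M x y =
      (1 / 2 : ℂ) • (siteRaise M x * siteLower M y + siteLower M x * siteRaise M y) := by
  rw [truncBond, siteCos_eq, siteCos_eq, siteSin_eq, siteSin_eq, smul_mul_smul, smul_mul_smul,
    show (-I / 2 : ℂ) * (-I / 2) = -(1 / 4) by
      rw [div_mul_div_comm, neg_mul_neg, Complex.I_mul_I]; norm_num,
    add_mul, mul_add, mul_add, sub_mul, mul_sub, mul_sub]
  module

/-- The bond operator is symmetric in its endpoints. [folklore] -/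
theorem truncBond_comm (x y : Λ) : truncBond M x y = truncBond M y x := by
  by_cases hxy : x = y
  · rw [hxy]
  · simp only [truncBond, siteCos, siteSin]
    rw [onSite_mul_onSite_comm hxy (truncCos M) (truncCos M),
      onSite_mul_onSite_comm hxy (truncSin M) (truncSin M)]

/-- `B_{xy}ᴴ = B_{yx}`. [folklore] -/
theorem truncBond_conjTranspose (x y : Λ) : (truncBond M x y)ᴴ = truncBond M y x := by
  simp only [truncBond, conjTranspose_add, conjTranspose_mul, (siteCos_isHermitian M _).eq,
    (siteSin_isHermitian M _).eq]

/-- The bond operator is Hermitian. [folklore] -/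
theorem truncBond_isHermitian (x y : Λ) : (truncBond M x y).IsHermitian := by
  rw [IsHermitian, truncBond_conjTranspose, truncBond_comm]

/-- The compressed Hamiltonian is Hermitian. [folklore] -/
theorem truncHamiltonian_isHermitian (nn : Λ → Λ → Prop) [DecidableRel nn] (h J : ℝ) :
    (truncHamiltonian M nn h J : Op Λ (2 * M + 1)).IsHermitian := by
  have hsa : ∀ r : ℝ, IsSelfAdjoint (r : ℂ) := fun r => by
    rw [IsSelfAdjoint, Complex.star_def, Complex.conj_ofReal]
  unfold truncHamiltonian
  refine IsHermitian.sub ?_ ?_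
  · refine (isSelfAdjoint_sum _ fun x _ => ?_).isHermitian
    exact (IsSelfAdjoint.smul (hsa _) (siteMomentumSq_isHermitian M x).isSelfAdjoint)
  · refine (isSelfAdjoint_sum _ fun x _ => isSelfAdjoint_sum _ fun y _ => ?_).isHermitian
    exact (IsSelfAdjoint.smul (hsa _) (truncBond_isHermitian M x y).isSelfAdjoint)

/-! #### `-1 ≤ cos(φ_x - φ_y) ≤ 1` survives the compression -/

/-- `U_xᴴ U_x = 1 - P^x_M` at the lattice level. [folklore] -/
theorem siteLower_mul_siteRaise (x : Λ) :
    siteLower M x * siteRaise M x = 1 - onSite x (truncTop M) := by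
  rw [siteLower, siteRaise, onSite_mul, truncRaise_transpose_mul_self, onSite_sub', onSite_one']

/-- `U_x U_xᴴ = 1 - P^x_{-M}` at the lattice level. [folklore] -/
theorem siteRaise_mul_siteLower (x : Λ) :
    siteRaise M x * siteLower M x = 1 - onSite x (truncBot M) := by
  rw [siteLower, siteRaise, onSite_mul, truncRaise_mul_transpose, onSite_sub', onSite_one']

/-- `2(1 - B_{xy}) = (U_x - U_y)ᴴ(U_x - U_y) + P^x_M + P^y_M` for `x ≠ y`. [folklore] -/
theorem two_smul_one_sub_truncBond {x y : Λ} (hxy : x ≠ y) :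
    (2 : ℂ) • (1 - truncBond M x y) =
      (siteRaise M x - siteRaise M y)ᴴ * (siteRaise M x - siteRaise M y) +
        (onSite x (truncTop M) + onSite y (truncTop M)) := by
  rw [conjTranspose_sub, siteRaise_conjTranspose, siteRaise_conjTranspose, sub_mul, mul_sub,
    mul_sub, siteLower_mul_siteRaise, siteLower_mul_siteRaise, truncBond_eq_half, smul_sub,
    smul_smul, show (2 : ℂ) * (1 / 2) = 1 by norm_num, one_smul]
  have hc : siteLower M y * siteRaise M x = siteRaise M x * siteLower M y := by
    rw [siteLower, siteRaise, onSite_mul_onSite_comm (Ne.symm hxy)]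
  rw [hc, two_smul]
  abel

/-- `2(1 + B_{xy}) = (U_x + U_y)ᴴ(U_x + U_y) + P^x_M + P^y_M` for `x ≠ y`. [folklore] -/
theorem two_smul_one_add_truncBond {x y : Λ} (hxy : x ≠ y) :
    (2 : ℂ) • (1 + truncBond M x y) =
      (siteRaise M x + siteRaise M y)ᴴ * (siteRaise M x + siteRaise M y) +
        (onSite x (truncTop M) + onSite y (truncTop M)) := by
  rw [conjTranspose_add, siteRaise_conjTranspose, siteRaise_conjTranspose, add_mul, mul_add,
    mul_add, siteLower_mul_siteRaise, siteLower_mul_siteRaise, truncBond_eq_half, smul_add,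
    smul_smul, show (2 : ℂ) * (1 / 2) = 1 by norm_num, one_smul]
  have hc : siteLower M y * siteRaise M x = siteRaise M x * siteLower M y := by
    rw [siteLower, siteRaise, onSite_mul_onSite_comm (Ne.symm hxy)]
  rw [hc, two_smul]
  abel

/-- `1 - (cos_x cos_y + sin_x sin_y) ≥ 0` for `x ≠ y`. [folklore] -/
theorem posSemidef_one_sub_truncBond {x y : Λ} (hxy : x ≠ y) :
    (1 - truncBond M x y : Op Λ (2 * M + 1)).PosSemidef := by
  have h2 : ((2 : ℂ) • (1 - truncBond M x y)).PosSemidef := by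
    rw [two_smul_one_sub_truncBond M hxy]
    exact (posSemidef_conjTranspose_mul_self _).add
      ((onSite_posSemidef x (posSemidef_truncTop M)).add
        (onSite_posSemidef y (posSemidef_truncTop M)))
  have h := h2.smul (show (0 : ℂ) ≤ (1 / 2 : ℂ) by
    rw [show (1 / 2 : ℂ) = ((1 / 2 : ℝ) : ℂ) by norm_num]; exact Complex.zero_le_real.2 (by norm_num))
  rwa [smul_smul, show (1 / 2 : ℂ) * 2 = 1 by norm_num, one_smul] at h

/-- `1 + (cos_x cos_y + sin_x sin_y) ≥ 0` for `x ≠ y`. [folklore] -/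
theorem posSemidef_one_add_truncBond {x y : Λ} (hxy : x ≠ y) :
    (1 + truncBond M x y : Op Λ (2 * M + 1)).PosSemidef := by
  have h2 : ((2 : ℂ) • (1 + truncBond M x y)).PosSemidef := by
    rw [two_smul_one_add_truncBond M hxy]
    exact (posSemidef_conjTranspose_mul_self _).add
      ((onSite_posSemidef x (posSemidef_truncTop M)).add
        (onSite_posSemidef y (posSemidef_truncTop M)))
  have h := h2.smul (show (0 : ℂ) ≤ (1 / 2 : ℂ) by
    rw [show (1 / 2 : ℂ) = ((1 / 2 : ℝ) : ℂ) by norm_num]; exact Complex.zero_le_real.2 (by norm_num))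
  rwa [smul_smul, show (1 / 2 : ℂ) * 2 = 1 by norm_num, one_smul] at h

/-! #### The truncation edge at the lattice level -/

/-- `cos_x² + sin_x² = 1 - ½(P^x_M + P^x_{-M})`. [folklore] -/
theorem siteCos_sq_add_siteSin_sq (x : Λ) :
    siteCos M x * siteCos M x + siteSin M x * siteSin M x =
      1 - (1 / 2 : ℂ) • (onSite x (truncTop M) + onSite x (truncBot M)) := by
  rw [siteCos, siteSin, onSite_mul, onSite_mul, ← onSite_add', truncCos_sq_add_truncSin_sq,
    onSite_sub', onSite_one', onSite_smul', onSite_add']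

/-- `[cos_x, sin_x] = (i/2)(P^x_M - P^x_{-M})`. [folklore] -/
theorem siteCos_mul_siteSin_sub (x : Λ) :
    siteCos M x * siteSin M x - siteSin M x * siteCos M x =
      (I / 2 : ℂ) • (onSite x (truncTop M) - onSite x (truncBot M)) := by
  rw [siteCos, siteSin, onSite_mul, onSite_mul, ← onSite_sub', truncCos_mul_truncSin_sub,
    onSite_smul', onSite_sub']

/-- Operators of one rotator at distinct sites commute. [folklore] -/
theorem siteCos_mul_siteSin_of_ne {x y : Λ} (hxy : x ≠ y) :
    siteCos M x * siteSin M y = siteSin M y * siteCos M x :=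
  onSite_mul_onSite_comm hxy _ _

/-- `cos φ_x` and `cos φ_y` commute for `x ≠ y`. [folklore] -/
theorem siteCos_mul_siteCos_of_ne {x y : Λ} (hxy : x ≠ y) :
    siteCos M x * siteCos M y = siteCos M y * siteCos M x :=
  onSite_mul_onSite_comm hxy _ _

/-- `sin φ_x` and `sin φ_y` commute for `x ≠ y`. [folklore] -/
theorem siteSin_mul_siteSin_of_ne {x y : Λ} (hxy : x ≠ y) :
    siteSin M x * siteSin M y = siteSin M y * siteSin M x :=
  onSite_mul_onSite_comm hxy _ _

/-- **Chebyshev at a site**: `M² (P^x_M + P^x_{-M}) ≤ N_x²`. [folklore] -/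
theorem posSemidef_siteMomentumSq_sub (x : Λ) :
    (siteMomentumSq M x -
      ((M : ℂ) ^ 2) • (onSite x (truncTop M) + onSite x (truncBot M)) : Op Λ (2 * M + 1)).PosSemidef := by
  rw [siteMomentumSq, ← onSite_add', ← onSite_smul', ← onSite_sub']
  exact onSite_posSemidef x (posSemidef_truncMomentum_sq_sub M)

/-- The edge projections at a site are positive semidefinite. [folklore] -/
theorem posSemidef_onSite_truncTop (x : Λ) :
    (onSite x (truncTop M) : Op Λ (2 * M + 1)).PosSemidef :=
  onSite_posSemidef x (posSemidef_truncTop M)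

/-- `P^x_{-M} ≥ 0`. [folklore] -/
theorem posSemidef_onSite_truncBot (x : Λ) :
    (onSite x (truncBot M) : Op Λ (2 * M + 1)).PosSemidef :=
  onSite_posSemidef x (posSemidef_truncBot M)

/-- The kinetic energy at a site is positive semidefinite. [folklore] -/
theorem posSemidef_siteMomentumSq (x : Λ) :
    (siteMomentumSq M x : Op Λ (2 * M + 1)).PosSemidef := by
  refine onSite_posSemidef x ?_
  have h := truncMomentum_isHermitian M
  nth_rewrite 1 [← h.eq]
  exact posSemidef_conjTranspose_mul_self _

end Lattice

end QuantumRotor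

end Literature.MathematicalPhysics.QuantumLattice
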